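import Summits.BirchSwinnertonDyer.BirchSwinnertonDyer.Theorems.DerivedCoinvariantProfileSchneider
import Literature.NumberTheory.LocalFields.StrassmannTheorem
import Literature.NumberTheory.EllipticCurves.PAdicRegulatorFiniteIndexProofs
import HarnessLib

/-!
# Pencil-class Schneider door: analytic variation of the `p`-adic regulator on a class of a rank-2 family
# ⇒ Schneider for ALL (or all but finitely many) members ⇒ `ord_T L_p = rank` for every such member with finite `Ш[p^∞]`

Cell `bsd-rank2`, seat p2 GEN 72 (kernel theorem K72; tenure route `EisensteinDepletionAtTwo`, purpose
«the exact extra input that turns the `p`-adic BSD inequality into equality on an infinite class»).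

THE INPUT ISOLATED. Fix a prime `p` and a CLASS of an algebraic family of elliptic curves over `ℚ`: members
`E τ` (`τ : T`, any index type; in practice `τ` runs over the rational parameters of one residue disc with fixed
local data at the finitely many bad places of the family), two sections `P τ, Q τ ∈ E_τ(ℚ)` and height data
`Dh τ` (the canonical cyclotomic `p`-adic height of `E τ`). The ANALYTIC-CLASS HYPOTHESES (`hcoeff`, `hreg` below) say that the
pair regulator `Reg_p(τ) := ⟨P,P⟩⟨Q,Q⟩ − ⟨P,Q⟩²` of the sections is the value at `param τ ∈ ℤ_p` of ONE restricted
power series `Σ aₙ Xⁿ`, `aₙ → 0` (analytic variation of `p`-adic heights in families: Wuthrich, J. London Math.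
Soc. 70 (2004) 23–40, where continuity is proved and non-degeneracy «can be checked simultaneously for almost all
elements of the family»; the restricted-power-series form per residue class is this seat's reading, carried here
as EXPLICIT HYPOTHESES of each theorem — nothing about heights is proved in this file). Given them, everything else
is kernel-checked `p`-adic analysis (Strassman's theorem, tree `Literature.NumberTheory.LocalFields.strassmann_padicInt`)
plus the GEN 70 door `order_eq_rank_iff_schneider_of_BCS`:

* `regulator_ne_zero_of_index_zero` — a `k = 0` Strassman certificate for the class (`‖aₙ‖ < ‖a₀‖` for `n ≥ 1`,
  a FINITE valuation table once a tail bound is known) forces `Reg_p(τ) ≠ 0` for EVERY member: Schneider's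
  conjecture (on the span of the sections; on `E_τ(ℚ)` when `rank E_τ(ℚ) = 2`, `schneiderConjecture_of_index_zero`)
  for an infinite class of curves from finitely many digits;
* `finite_degenerate_of_exists_ne_zero` — ONE member with `Reg_p(τ₀) ≠ 0` already makes the degenerate members of
  the class FINITE (Strassman finiteness; `ncard_degenerate_le` bounds their number by the Strassman index) —
  cofinitely many, not merely density one;
* `regulator_ne_zero_near_of_continuousWithinAt` — the continuity-only form (the part of Wuthrich 2004 that is
  uncontroversially in print): `Reg_p(τ₀) ≠ 0` propagates to every member `p`-adically close enough to `τ₀`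
  (an infinite sub-class `τ ≡ τ₀ (mod p^k M)`), with no analyticity;
* `order_eq_rank_of_index_zero`, `order_eq_rank_of_cofinite` — THE DOOR: granting the two prints of GEN 70
  (`Schneider1985_order_charGenerator`, `burungale_castella_skinner_charIdeal_eq_padicLFunction`), for a member of
  such a class at a good ordinary `p ≥ 5` with irreducible `ρ̄_{E,p}` and `rank E_τ(ℚ) = 2`, the ONLY remaining
  input for `ord_{T=0} L_p(E_τ,T) = rank E_τ(ℚ)` is `#Ш(E_τ/ℚ)[p^∞] < ∞`.

Honesty (Barrier B1 of the cell): no motion on `S0` (`Ш[p^∞]`-finiteness in rank 2) is claimed; the file turns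
the Schneider half of the equality input into (analytic-variation hypothesis) + (one finite certificate per class).

References: Wuthrich, On `p`-adic heights in families of elliptic curves, J. London Math. Soc. (2) 70 (2004)
23–40, doi:10.1112/S0024610704005277 [Wuthrich2004]; F. Q. Gouvêa, *p-adic Numbers*, Thm. 5.6.1 [Gouvea1993PadicNumbers];
Mazur–Tate–Teitelbaum 1986 §II.4 [MazurTateTeitelbaum1986Invent]; Schneider 1985 [Schneider1985];
Burungale–Castella–Skinner 2024 (base-change-free cyclotomic main conjecture).
-/

set_option linter.dupNamespace false

noncomputable section

open Filter Topology
open scoped BigOperators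
open scoped MatrixGroups ModularForm
open CongruenceSubgroup WeierstrassCurve
open Literature.NumberTheory.EllipticCurves Literature.NumberTheory.LocalFields
  Literature.NumberTheory.EllipticCurves.ModularForms
open Summit.BirchSwinnertonDyer.BirchSwinnertonDyer.Theorems.DerivedCoinvariantProfileSchneider
  Summit.BirchSwinnertonDyer.BirchSwinnertonDyer.Theorems.DerivedCoinvariantProfileAtPoint

namespace Summit.BirchSwinnertonDyer.BirchSwinnertonDyer.Theorems.PencilClassSchneiderDoor

variable {p : ℕ} [Fact p.Prime] {T : Type*} {E : T → WeierstrassCurve ℚ}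
  {P Q : ∀ τ, (E τ).toAffine.Point} {Dh : ∀ τ, PAdicHeightData (E τ) p}

/-! ## Analytic class hypotheses

Members `E τ`, sections `P τ, Q τ`, height data `Dh τ`; `param τ ∈ ℤ_p` is the `p`-adic position of the member in
its residue class and `coeff` ONE coefficient sequence `aₙ → 0` (`hcoeff`) with
`Reg_p(τ) = ⟨P,P⟩⟨Q,Q⟩ − ⟨P,Q⟩² = Σₙ aₙ (param τ)ⁿ` for every member (`hreg`). The series converges on `ℤ_p` because
`aₙ → 0` (`summable_mul_pow_of_tendsto_zero`), so `hreg` carries no junk value. -/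

section AnalyticClass

variable (param : T → ℤ_[p]) (coeff : ℕ → ℚ_[p])

/-- The degenerate members are those whose position is a zero of the class series. [folklore] -/
theorem regulator_eq_zero_iff
    (hreg : ∀ τ, padicRegulatorOf (Dh τ) ![P τ, Q τ] = ∑' n, coeff n * (param τ : ℚ_[p]) ^ n) (τ : T) :
    padicRegulatorOf (Dh τ) ![P τ, Q τ] = 0 ↔ ∑' n, coeff n * (param τ : ℚ_[p]) ^ n = 0 := by
  rw [hreg]

/-- **Strassman finiteness on a class.** If the class series is not identically zero and `param` is injective
(distinct members sit at distinct `p`-adic positions), only FINITELY many members have degenerate pair regulator.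
[cite: Gouvea1993PadicNumbers, §5.6 Cor. 5.6.3] -/
theorem finite_degenerate (hcoeff : Tendsto coeff atTop (𝓝 0))
    (hreg : ∀ τ, padicRegulatorOf (Dh τ) ![P τ, Q τ] = ∑' n, coeff n * (param τ : ℚ_[p]) ^ n)
    (hne : coeff ≠ 0) (hinj : Function.Injective param) :
    {τ : T | padicRegulatorOf (Dh τ) ![P τ, Q τ] = 0}.Finite := by
  have hfin := finite_zeros_padicInt hcoeff hne
  have hsub : {τ : T | padicRegulatorOf (Dh τ) ![P τ, Q τ] = 0} ⊆
      param ⁻¹' {x : ℤ_[p] | ∑' n, coeff n * (x : ℚ_[p]) ^ n = 0} := by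
    intro τ hτ
    simpa [hreg] using hτ
  exact (hfin.preimage hinj.injOn).subset hsub

/-- **One certificate ⇒ cofinitely many.** If ONE member `τ₀` has `Reg_p(τ₀) ≠ 0`, the class series is non-zero,
so the degenerate members of the class form a finite set. [cite: Gouvea1993PadicNumbers, §5.6 Cor. 5.6.3] -/
theorem finite_degenerate_of_exists_ne_zero (hcoeff : Tendsto coeff atTop (𝓝 0))
    (hreg : ∀ τ, padicRegulatorOf (Dh τ) ![P τ, Q τ] = ∑' n, coeff n * (param τ : ℚ_[p]) ^ n)
    (hinj : Function.Injective param) {τ₀ : T} (h₀ : padicRegulatorOf (Dh τ₀) ![P τ₀, Q τ₀] ≠ 0) :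
    {τ : T | padicRegulatorOf (Dh τ) ![P τ, Q τ] = 0}.Finite := by
  refine finite_degenerate param coeff hcoeff hreg ?_ hinj
  intro hzero
  apply h₀
  rw [hreg]
  simp [hzero]

/-- **Strassman count on a class.** With Strassman index `N` (`a_N ≠ 0`, `‖aₙ‖ ≤ ‖a_N‖` for all `n`, `<` beyond
`N`) and injective `param`, at most `N` members of the class are degenerate.
[cite: Gouvea1993PadicNumbers, §5.6 Thm. 5.6.1] -/
theorem ncard_degenerate_le (hcoeff : Tendsto coeff atTop (𝓝 0))
    (hreg : ∀ τ, padicRegulatorOf (Dh τ) ![P τ, Q τ] = ∑' n, coeff n * (param τ : ℚ_[p]) ^ n)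
    (hinj : Function.Injective param) {N : ℕ} (h0 : coeff N ≠ 0)
    (hN : ∀ n, ‖coeff n‖ ≤ ‖coeff N‖) (hN' : ∀ n, N < n → ‖coeff n‖ < ‖coeff N‖) :
    {τ : T | padicRegulatorOf (Dh τ) ![P τ, Q τ] = 0}.ncard ≤ N := by
  classical
  obtain ⟨s, hs, hmem⟩ := strassmann_padicInt hcoeff h0 hN hN'
  have hsub : {τ : T | padicRegulatorOf (Dh τ) ![P τ, Q τ] = 0} ⊆ param ⁻¹' (s : Set ℤ_[p]) := by
    intro τ hτ
    have : ∑' n, coeff n * (param τ : ℚ_[p]) ^ n = 0 := by simpa [hreg] using hτ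
    exact hmem _ this
  calc {τ : T | padicRegulatorOf (Dh τ) ![P τ, Q τ] = 0}.ncard
      ≤ (s : Set ℤ_[p]).ncard :=
        Set.ncard_le_ncard_of_injOn param (fun τ hτ => hsub hτ) hinj.injOn s.finite_toSet
    _ = s.card := Set.ncard_coe_finset s
    _ ≤ N := hs

/-- **Index-zero certificate ⇒ NO degenerate member.** If `‖aₙ‖ < ‖a₀‖` for every `n ≥ 1` (Strassman index
`0`: in practice a finite table of valuations plus a tail bound), then `Reg_p(τ) ≠ 0` for EVERY member of the
class — infinitely many curves from finitely many `p`-adic digits. [cite: Gouvea1993PadicNumbers, §5.6 Thm. 5.6.1] -/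
theorem regulator_ne_zero_of_index_zero (hcoeff : Tendsto coeff atTop (𝓝 0))
    (hreg : ∀ τ, padicRegulatorOf (Dh τ) ![P τ, Q τ] = ∑' n, coeff n * (param τ : ℚ_[p]) ^ n)
    (h : ∀ n, 0 < n → ‖coeff n‖ < ‖coeff 0‖) (τ : T) :
    padicRegulatorOf (Dh τ) ![P τ, Q τ] ≠ 0 := by
  classical
  have h0 : coeff 0 ≠ 0 := by
    intro h0
    have := h 1 one_pos
    rw [h0, norm_zero] at this
    exact absurd this (not_lt.mpr (norm_nonneg (coeff 1)))
  have hN : ∀ n, ‖coeff n‖ ≤ ‖coeff 0‖ := by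
    intro n
    rcases Nat.eq_zero_or_pos n with rfl | hn
    · exact le_rfl
    · exact (h n hn).le
  obtain ⟨s, hs, hmem⟩ := strassmann_padicInt hcoeff h0 hN (fun n hn => h n hn)
  have hs0 : s = ∅ := Finset.card_eq_zero.mp (Nat.le_zero.mp hs)
  intro hτ
  have := hmem (param τ) (by simpa [hreg] using hτ)
  simp [hs0] at this

/-- **Schneider on the whole class.** Under an index-zero certificate every member with `rank E_τ(ℚ) = 2`
satisfies Schneider's conjecture for its height datum (the sections then have finite index and
`Reg(P,Q) = I² · Reg_p(E_τ)`). [cite: MazurTateTeitelbaum1986Invent, §II.4] [cite: Schneider1982PadicHeightI, §1] -/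
theorem schneiderConjecture_of_index_zero [∀ τ, (E τ).IsElliptic] (hcoeff : Tendsto coeff atTop (𝓝 0))
    (hreg : ∀ τ, padicRegulatorOf (Dh τ) ![P τ, Q τ] = ∑' n, coeff n * (param τ : ℚ_[p]) ^ n)
    (h : ∀ n, 0 < n → ‖coeff n‖ < ‖coeff 0‖) (τ : T) (hrank : (E τ).mordellWeilRank = 2) :
    SchneiderConjecture (Dh τ) :=
  schneiderConjecture_of_padicRegulatorOf_pair_ne_zero (Dh τ) (P τ) (Q τ) hrank
    (regulator_ne_zero_of_index_zero param coeff hcoeff hreg h τ)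

/-- **Schneider for all but finitely many.** From one non-degenerate member: off a finite exceptional set, every
member with `rank E_τ(ℚ) = 2` satisfies Schneider's conjecture. [cite: MazurTateTeitelbaum1986Invent, §II.4] -/
theorem schneiderConjecture_of_cofinite [∀ τ, (E τ).IsElliptic] (hcoeff : Tendsto coeff atTop (𝓝 0))
    (hreg : ∀ τ, padicRegulatorOf (Dh τ) ![P τ, Q τ] = ∑' n, coeff n * (param τ : ℚ_[p]) ^ n)
    (hinj : Function.Injective param) {τ₀ : T} (h₀ : padicRegulatorOf (Dh τ₀) ![P τ₀, Q τ₀] ≠ 0) :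
    ∃ X : Set T, X.Finite ∧ ∀ τ ∉ X, (E τ).mordellWeilRank = 2 → SchneiderConjecture (Dh τ) := by
  refine ⟨{τ : T | padicRegulatorOf (Dh τ) ![P τ, Q τ] = 0},
    finite_degenerate_of_exists_ne_zero param coeff hcoeff hreg hinj h₀,
    fun τ hτ hrank => ?_⟩
  exact schneiderConjecture_of_padicRegulatorOf_pair_ne_zero (Dh τ) (P τ) (Q τ) hrank hτ

end AnalyticClass

/-! ## The continuity-only form (no analyticity): non-degeneracy is `p`-adically open in the class -/

/-- **Continuity ⇒ an infinite non-degenerate sub-class.** If the pair regulator is the value of a function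
`F : ℤ_p → ℚ_p` at the member's position, `F` is continuous at the position of `τ₀` within the set of positions,
and `Reg_p(τ₀) ≠ 0`, then there is `k` such that EVERY member whose position is congruent to that of `τ₀`
modulo `p^k` has `Reg_p ≠ 0` (for a residue-class parametrisation: all `τ ≡ τ₀ (mod p^k·M)`). This uses only
`p`-adic continuity of heights in families (Wuthrich 2004, main theorem as stated in the abstract); no source
fact is invoked in the proof, which is point-set topology. [cite: Wuthrich2004, §1 (main theorem: continuity)] -/
theorem regulator_ne_zero_near_of_continuousWithinAt (param : T → ℤ_[p]) (F : ℤ_[p] → ℚ_[p])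
    (hF : ∀ τ, padicRegulatorOf (Dh τ) ![P τ, Q τ] = F (param τ)) {τ₀ : T}
    (hcont : ContinuousWithinAt F (Set.range param) (param τ₀))
    (h₀ : padicRegulatorOf (Dh τ₀) ![P τ₀, Q τ₀] ≠ 0) :
    ∃ k : ℕ, ∀ τ, ‖param τ - param τ₀‖ ≤ (p : ℝ) ^ (-(k : ℤ)) →
      padicRegulatorOf (Dh τ) ![P τ, Q τ] ≠ 0 := by
  have hp : (1 : ℝ) < p := by exact_mod_cast (Fact.out : p.Prime).one_lt
  have hne : F (param τ₀) ≠ 0 := by rwa [← hF]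
  -- `F` stays non-zero on a neighbourhood of `param τ₀` within the range of `param`
  have hev : ∀ᶠ x in 𝓝[Set.range param] (param τ₀), F x ≠ 0 :=
    hcont.eventually_ne hne
  obtain ⟨ε, hε, hball⟩ := Metric.mem_nhdsWithin_iff.mp hev
  obtain ⟨k, hk⟩ := exists_pow_lt_of_lt_one hε (inv_lt_one_of_one_lt₀ hp)
  refine ⟨k, fun τ hτ => ?_⟩
  rw [hF]
  have hdist : dist (param τ) (param τ₀) < ε := by
    rw [dist_eq_norm]
    refine lt_of_le_of_lt hτ ?_
    simpa [zpow_neg, zpow_natCast, inv_pow] using hk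
  exact hball ⟨Metric.mem_ball.mpr hdist, ⟨τ, rfl⟩⟩

/-! ## The door: composition with `ord_T f_E = rank ⟺ Schneider ∧ Ш[p^∞] finite` (GEN 70) -/

section Door

variable [∀ τ, (E τ).IsElliptic] [∀ τ, (E τ).IsGloballyMinimal]

/-- **Per-member door (no family).** Granting the two prints of GEN 70, at a good ordinary `p ≥ 5` with
irreducible `ρ̄_{E,p}`: if `rank E(ℚ) = 2`, two points have non-zero pair regulator for the canonical height, and
`Ш(E/ℚ)[p^∞]` is finite, then `ord_{T=0} L_p(E,T) = rank E(ℚ)`.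
[cite: Schneider1985, Thm. 2′ (p. 342)] [cite: MazurTateTeitelbaum1986Invent, §II.4] -/
theorem order_eq_rank_of_pair_ne_zero (W : WeierstrassCurve ℚ) [W.IsElliptic] [W.IsGloballyMinimal]
    (h85 : Schneider1985_order_charGenerator)
    (hBCS : burungale_castella_skinner_charIdeal_eq_padicLFunction) (hp : 5 ≤ p)
    (hgood : W.HasGoodReductionAtPrime p) (hord : ¬ (p : ℤ) ∣ W.frobeniusTrace p)
    (hirr : W.HasIrreducibleModPGaloisRep p) {N : ℕ} [NeZero N] {f : CuspForm (Gamma0 N) 2}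
    (hf : IsNewformOf W f) {D : PAdicHeightData W p} (hD : D.IsCanonical) (P₁ P₂ : W.toAffine.Point)
    (hrank : W.mordellWeilRank = 2) (hreg : padicRegulatorOf D ![P₁, P₂] ≠ 0)
    (hfin : Finite (AddCommGroup.primaryComponent W.sha p)) :
    (padicLFunction f (unitRoot W p : ℚ_[p])).order = W.mordellWeilRank := by
  obtain ⟨κ, hκ, γ, hγ, hγ'⟩ := exists_isCyclotomic_isTopGenerator_isCyclotomicVariable_holds p
  obtain ⟨Dsel⟩ := W.nonempty_selmerDualData_holds κ γ hγ
  exact (order_eq_rank_iff_schneider_of_BCS p W f h85 hBCS hp hgood hord hirr hκ hγ hγ' hf Dsel hD).mpr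
    ⟨schneiderConjecture_of_padicRegulatorOf_pair_ne_zero D P₁ P₂ hrank hreg, hfin⟩

/-- **THE DOOR on an index-zero class.** For a class with analytic pair regulator and an index-`0` Strassman
certificate, EVERY member `E τ` at a good ordinary `p ≥ 5` with irreducible `ρ̄`, canonical height datum,
`rank E_τ(ℚ) = 2` and finite `Ш(E_τ/ℚ)[p^∞]` has `ord_{T=0} L_p(E_τ,T) = rank E_τ(ℚ) (= 2)`, granting the two
prints. The equality input beyond the prints is thus: the class datum, ONE finite certificate, and
`Ш[p^∞]`-finiteness per member. [cite: Schneider1985, Thm. 2′ (p. 342)] [cite: Gouvea1993PadicNumbers, §5.6 Thm. 5.6.1] -/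
theorem order_eq_rank_of_index_zero (param : T → ℤ_[p]) (coeff : ℕ → ℚ_[p])
    (hcoeff : Tendsto coeff atTop (𝓝 0))
    (hreg : ∀ τ, padicRegulatorOf (Dh τ) ![P τ, Q τ] = ∑' n, coeff n * (param τ : ℚ_[p]) ^ n)
    (hcert : ∀ n, 0 < n → ‖coeff n‖ < ‖coeff 0‖)
    (h85 : Schneider1985_order_charGenerator)
    (hBCS : burungale_castella_skinner_charIdeal_eq_padicLFunction) (hp : 5 ≤ p) (τ : T)
    (hgood : (E τ).HasGoodReductionAtPrime p) (hord : ¬ (p : ℤ) ∣ (E τ).frobeniusTrace p)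
    (hirr : (E τ).HasIrreducibleModPGaloisRep p) {N : ℕ} [NeZero N] {f : CuspForm (Gamma0 N) 2}
    (hf : IsNewformOf (E τ) f) (hDh : (Dh τ).IsCanonical) (hrank : (E τ).mordellWeilRank = 2)
    (hfin : Finite (AddCommGroup.primaryComponent (E τ).sha p)) :
    (padicLFunction f (unitRoot (E τ) p : ℚ_[p])).order = (E τ).mordellWeilRank :=
  order_eq_rank_of_pair_ne_zero (E τ) h85 hBCS hp hgood hord hirr hf hDh (P τ) (Q τ) hrank
    (regulator_ne_zero_of_index_zero param coeff hcoeff hreg hcert τ) hfin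

/-- **THE DOOR, cofinite form.** From ONE non-degenerate member of an analytic class (injective positions) there
is a finite exceptional set `X` off which every member satisfying the standing hypotheses and with finite
`Ш[p^∞]` has `ord_{T=0} L_p = rank`. [cite: Schneider1985, Thm. 2′ (p. 342)] [cite: Gouvea1993PadicNumbers, §5.6 Cor. 5.6.3] -/
theorem order_eq_rank_of_cofinite (param : T → ℤ_[p]) (coeff : ℕ → ℚ_[p])
    (hcoeff : Tendsto coeff atTop (𝓝 0))
    (hreg : ∀ τ, padicRegulatorOf (Dh τ) ![P τ, Q τ] = ∑' n, coeff n * (param τ : ℚ_[p]) ^ n)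
    (hinj : Function.Injective param) {τ₀ : T} (h₀ : padicRegulatorOf (Dh τ₀) ![P τ₀, Q τ₀] ≠ 0)
    (h85 : Schneider1985_order_charGenerator)
    (hBCS : burungale_castella_skinner_charIdeal_eq_padicLFunction) (hp : 5 ≤ p) :
    ∃ X : Set T, X.Finite ∧ ∀ τ ∉ X,
      (E τ).HasGoodReductionAtPrime p → ¬ (p : ℤ) ∣ (E τ).frobeniusTrace p →
      (E τ).HasIrreducibleModPGaloisRep p → ∀ {N : ℕ} [NeZero N] {f : CuspForm (Gamma0 N) 2},
      IsNewformOf (E τ) f → (Dh τ).IsCanonical → (E τ).mordellWeilRank = 2 →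
      Finite (AddCommGroup.primaryComponent (E τ).sha p) →
      (padicLFunction f (unitRoot (E τ) p : ℚ_[p])).order = (E τ).mordellWeilRank := by
  refine ⟨{τ : T | padicRegulatorOf (Dh τ) ![P τ, Q τ] = 0},
    finite_degenerate_of_exists_ne_zero param coeff hcoeff hreg hinj h₀,
    fun τ hτ hgood hord hirr N _ f hf hDh hrank hfin => ?_⟩
  exact order_eq_rank_of_pair_ne_zero (E τ) h85 hBCS hp hgood hord hirr hf hDh (P τ) (Q τ) hrank hτ hfin

/-- **THE DOOR, continuity form.** With only continuity of the regulator at the position of a non-degenerate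
member `τ₀`: for some `k`, every member within `p^{-k}` of `τ₀` (an infinite congruence sub-class) satisfying the
standing hypotheses and with finite `Ш[p^∞]` has `ord_{T=0} L_p = rank`. [cite: Schneider1985, Thm. 2′ (p. 342)] -/
theorem order_eq_rank_near_of_continuousWithinAt (param : T → ℤ_[p]) (F : ℤ_[p] → ℚ_[p])
    (hF : ∀ τ, padicRegulatorOf (Dh τ) ![P τ, Q τ] = F (param τ)) {τ₀ : T}
    (hcont : ContinuousWithinAt F (Set.range param) (param τ₀))
    (h₀ : padicRegulatorOf (Dh τ₀) ![P τ₀, Q τ₀] ≠ 0)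
    (h85 : Schneider1985_order_charGenerator)
    (hBCS : burungale_castella_skinner_charIdeal_eq_padicLFunction) (hp : 5 ≤ p) :
    ∃ k : ℕ, ∀ τ, ‖param τ - param τ₀‖ ≤ (p : ℝ) ^ (-(k : ℤ)) →
      (E τ).HasGoodReductionAtPrime p → ¬ (p : ℤ) ∣ (E τ).frobeniusTrace p →
      (E τ).HasIrreducibleModPGaloisRep p → ∀ {N : ℕ} [NeZero N] {f : CuspForm (Gamma0 N) 2},
      IsNewformOf (E τ) f → (Dh τ).IsCanonical → (E τ).mordellWeilRank = 2 →
      Finite (AddCommGroup.primaryComponent (E τ).sha p) →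
      (padicLFunction f (unitRoot (E τ) p : ℚ_[p])).order = (E τ).mordellWeilRank := by
  obtain ⟨k, hk⟩ := regulator_ne_zero_near_of_continuousWithinAt param F hF hcont h₀
  refine ⟨k, fun τ hτ hgood hord hirr N _ f hf hDh hrank hfin => ?_⟩
  exact order_eq_rank_of_pair_ne_zero (E τ) h85 hBCS hp hgood hord hirr hf hDh (P τ) (Q τ) hrank
    (hk τ hτ) hfin

end Door

end Summit.BirchSwinnertonDyer.BirchSwinnertonDyer.Theorems.PencilClassSchneiderDoor

end
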